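import Mathlib

/-!
# Transposition sieve — the group-theoretic core (solo-blind s42)

For a subgroup `H ≤ Perm α` put `x ∼ y :⟺ x = y ∨ swap x y ∈ H`.  This is an `H`-invariant
equivalence relation (its classes are the "transposition blocks" of `H`); all pairs are related
iff `H = ⊤` (finite `α`); and a transposition lying in `H` sits inside a class of *every*
`H`-invariant equivalence relation unless both of its points are singletons for that relation.
Consequently a subgroup containing a transposition is either the full symmetric group or
preserves a non-trivial equivalence relation with a class of size ≥ 2 (it is imprimitive as soon
as it is transitive).  This is the permutation-group half of the "transposition sieve" for
one-family carrier presentations (work/s42/type1-imprimitive.md §4): local monodromy at a simple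
tangency is a transposition, so a deficient monodromy group containing one is block-full
imprimitive and the carrier class descends to the block cover.
-/

namespace Summit.HodgeConjecture.HodgeConjecture.Theorems.TranspositionSieve

open Equiv

variable {α : Type*} [DecidableEq α]

/-- The swap relation of `H`: `x ∼ y` iff `x = y` or the transposition `swap x y` lies in `H`. -/
def SwapRel (H : Subgroup (Perm α)) (x y : α) : Prop := x = y ∨ swap x y ∈ H

/-- The swap relation is reflexive. -/
theorem swapRel_refl (H : Subgroup (Perm α)) (x : α) : SwapRel H x x := Or.inl rfl

/-- The swap relation is symmetric (`swap x y = swap y x`). -/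
theorem swapRel_symm {H : Subgroup (Perm α)} {x y : α} (h : SwapRel H x y) : SwapRel H y x := by
  rcases h with h | h
  · exact Or.inl h.symm
  · exact Or.inr (by rw [swap_comm]; exact h)

/-- The swap relation is transitive (`swap a c` is a word in `swap a b`, `swap b c`). -/
theorem swapRel_trans {H : Subgroup (Perm α)} {x y z : α} (hxy : SwapRel H x y)
    (hyz : SwapRel H y z) : SwapRel H x z := by
  rcases hxy with rfl | hxy
  · exact hyz
  rcases hyz with rfl | hyz
  · exact Or.inr hxy
  exact Or.inr (SubmonoidClass.swap_mem_trans H hxy hyz)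

/-- The swap relation is an equivalence relation. -/
theorem swapRel_equivalence (H : Subgroup (Perm α)) : Equivalence (SwapRel H) :=
  ⟨swapRel_refl H, swapRel_symm, swapRel_trans⟩

/-- The swap relation as a `Setoid` (its classes are the transposition blocks). -/
def swapSetoid (H : Subgroup (Perm α)) : Setoid α := ⟨SwapRel H, swapRel_equivalence H⟩

/-- Inside a transposition block every transposition lies in `H`. -/
theorem swap_mem_of_swapRel {H : Subgroup (Perm α)} {x y : α} (hxy : x ≠ y)
    (h : SwapRel H x y) : swap x y ∈ H := h.resolve_left hxy

/-- The swap relation is `H`-invariant: the transposition blocks form a block system. -/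
theorem swapRel_map {H : Subgroup (Perm α)} {h : Perm α} (hh : h ∈ H) {x y : α}
    (hxy : SwapRel H x y) : SwapRel H (h x) (h y) := by
  rcases hxy with rfl | hxy
  · exact Or.inl rfl
  · refine Or.inr ?_
    rw [Equiv.swap_apply_apply]
    exact H.mul_mem (H.mul_mem hh hxy) (H.inv_mem hh)

/-- `H`-invariance of the swap relation, as an iff. -/
theorem swapRel_map_iff {H : Subgroup (Perm α)} {h : Perm α} (hh : h ∈ H) {x y : α} :
    SwapRel H (h x) (h y) ↔ SwapRel H x y := by
  refine ⟨fun hxy => ?_, swapRel_map hh⟩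
  simpa using swapRel_map (H.inv_mem hh) hxy

/-- If all pairs are swap-related then `H` is the whole symmetric group. -/
theorem eq_top_of_swapRel_all [Finite α] {H : Subgroup (Perm α)}
    (hall : ∀ x y : α, SwapRel H x y) : H = ⊤ := by
  rw [eq_top_iff, ← Equiv.Perm.closure_isSwap, Subgroup.closure_le]
  rintro σ ⟨x, y, hxy, rfl⟩
  exact (hall x y).resolve_left hxy

/-- Conversely the full symmetric group relates everything. -/
theorem swapRel_all_of_eq_top {H : Subgroup (Perm α)} (htop : H = ⊤) (x y : α) :
    SwapRel H x y := Or.inr (htop ▸ Subgroup.mem_top _)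

/-- A transposition in `H` lies inside a class of ANY `H`-invariant equivalence relation `R`,
unless both of its points are `R`-singletons.  (In an imprimitive group with blocks of size ≥ 2,
transpositions never move a block.) -/
theorem swap_within_class {H : Subgroup (Perm α)} {R : α → α → Prop} (hR : Equivalence R)
    (hinv : ∀ h ∈ H, ∀ x y, R x y → R (h x) (h y)) {a b : α} (hmem : swap a b ∈ H) :
    R a b ∨ ((∀ z, R a z → z = a) ∧ (∀ z, R b z → z = b)) := by
  by_cases hab : R a b
  · exact Or.inl hab
  refine Or.inr ⟨fun z haz => ?_, fun z hbz => ?_⟩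
  · by_contra hza
    have hzb : z ≠ b := by rintro rfl; exact hab haz
    have h1 := hinv _ hmem a z haz
    rw [swap_apply_left, swap_apply_of_ne_of_ne hza hzb] at h1
    exact hab (hR.trans haz (hR.symm h1))
  · by_contra hzb
    have hza : z ≠ a := by rintro rfl; exact hab (hR.symm hbz)
    have h1 := hinv _ hmem b z hbz
    rw [swap_apply_right, swap_apply_of_ne_of_ne hza hzb] at h1
    exact hab (hR.trans h1 (hR.symm hbz))

/-- THE SIEVE.  A subgroup of a finite symmetric group containing a transposition is either the
whole symmetric group, or its swap relation is a non-trivial `H`-invariant equivalence relation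
with a class of size ≥ 2 (a genuine block system when `H` is transitive). -/
theorem sieve [Finite α] {H : Subgroup (Perm α)} {a b : α} (hab : a ≠ b)
    (hmem : swap a b ∈ H) :
    H = ⊤ ∨
      ((∀ h ∈ H, ∀ x y, SwapRel H x y ↔ SwapRel H (h x) (h y)) ∧
        (∃ x y, x ≠ y ∧ SwapRel H x y) ∧ (∃ x y, ¬ SwapRel H x y)) := by
  by_cases hall : ∀ x y : α, SwapRel H x y
  · exact Or.inl (eq_top_of_swapRel_all hall)
  · simp only [not_forall] at hall
    obtain ⟨x, y, hxy⟩ := hall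
    exact Or.inr ⟨fun h hh x y => (swapRel_map_iff hh).symm, ⟨a, b, hab, Or.inr hmem⟩, ⟨x, y, hxy⟩⟩

/-- Transitive + generated by transpositions (and identities) ⇒ full symmetric group: the case
"every branch curve has transposition (or trivial) local monodromy" of the sieve.  This is
Mathlib's `closure_of_isSwap_of_isPretransitive`, restated with identities allowed. -/
theorem eq_top_of_generated_by_swaps [Finite α] {S : Set (Perm α)}
    (hS : ∀ σ ∈ S, σ = 1 ∨ σ.IsSwap)
    [MulAction.IsPretransitive (Subgroup.closure S) α] : Subgroup.closure S = ⊤ := by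
  apply eq_top_of_swapRel_all
  intro x y
  by_cases hxy : x = y
  · exact Or.inl hxy
  · refine Or.inr ((swap_mem_closure_isSwap' S hS).2 ?_)
    exact MulAction.IsPretransitive.exists_smul_eq (M := Subgroup.closure S) y x
  where
  /-- helper: with identities allowed in `S`, a swap lies in the closure iff its points share an
  orbit — reduce to Mathlib's `swap_mem_closure_isSwap` for `S \ {1}`. -/
  swap_mem_closure_isSwap' (S : Set (Perm α)) (hS : ∀ σ ∈ S, σ = 1 ∨ σ.IsSwap) {x y : α} :
      swap x y ∈ Subgroup.closure S ↔
        ∃ g : Subgroup.closure S, g • y = x := by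
    have hcl : Subgroup.closure (S \ {1}) = Subgroup.closure S := by
      apply le_antisymm (Subgroup.closure_mono fun σ hσ => hσ.1)
      rw [Subgroup.closure_le]
      intro σ hσ
      by_cases h1 : σ = 1
      · rw [h1]; exact Subgroup.one_mem _
      · exact Subgroup.subset_closure ⟨hσ, h1⟩
    have hS' : ∀ f ∈ S \ {1}, f.IsSwap := fun f hf => (hS f hf.1).resolve_left hf.2
    have key := swap_mem_closure_isSwap hS' (x := x) (y := y)
    rw [hcl] at key
    rw [key, MulAction.mem_orbit_iff]

end Summit.HodgeConjecture.HodgeConjecture.Theorems.TranspositionSieve
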